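import Literature.Probability.Distributions.CharFunInversionRadial
import Mathlib.Probability.Distributions.Gaussian.Multivariate
import Mathlib.MeasureTheory.Measure.LevyConvergence
import Mathlib.MeasureTheory.Integral.RieszMarkovKakutani.Real
import HarnessLib

/-!
# Hankel inversion in the plane beyond `L¹`: radial characteristic functions with
# `√r φ(r) ∈ L¹(0, ∞)` (Gaussian damping)

Sequel of `CharFunInversionRadial.lean`. There a probability measure `μ` on `ℂ ≅ ℝ²` with RADIAL
characteristic function `charFun μ ξ = φ(‖ξ‖)` and `r φ(r) ∈ L¹(0,∞)` (so `charFun μ ∈ L¹(ℂ)`) was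
shown to have the continuous density `(2π)⁻¹ ∫₀^∞ r φ(r) J₀(r‖z‖) dr`. Here the integrability
hypothesis is weakened to

  `√r φ(r) ∈ L¹(0, ∞)`                                                    (H)

— e.g. `φ = J₀⁴` (`φ(r) ≍ r^{−2}`, the four-step uniform random walk, for which `charFun μ ∉ L¹(ℂ)`):
the order-`0` Hankel integral `g_φ(z) = (2π)⁻¹ ∫₀^∞ r φ(r) J₀(r‖z‖) dr` (`hankelDensity φ z`) still
converges absolutely for `z ≠ 0` because `|J₀(x)| ≤ C x^{−1/2}`, and

* `eq_withDensity_hankelDensity` — **`μ = g_φ · Lebesgue`**;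
* `continuousOn_hankelDensity` — `g_φ` is continuous on `ℂ ∖ {0}`, with
  `|g_φ(z)| ≤ B ‖z‖^{−1/2}` (`abs_hankelDensity_le`);
* `map_norm_eq_withDensity_hankelDensity` — the law of `‖X‖`, `X ∼ μ`, is `2πx g_φ(x) dx` on
  `(0, ∞)`.

Proof (Gaussian damping / Abel summation of the inversion integral): `μ_ε = μ ∗ N(0, ε²I)`
(`gaussConv μ ε`, Mathlib's `stdGaussian`) has radial characteristic function
`φ_ε(r) = φ(r) e^{−ε²r²/2}` (`gaussDamp`), to which `CharFunInversionRadial.lean` applies: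
`μ_ε = g_{φ_ε} · Lebesgue`. As `ε → 0`: `g_{φ_ε}(z) → g_φ(z)` for `z ≠ 0` by dominated convergence
(majorant `C ‖z‖^{−1/2} √r |φ(r)|`), hence `∫ h g_{φ_ε} → ∫ h g_φ` for `h ∈ C_c(ℂ)`
(majorant `‖h‖_∞ B ‖z‖^{−1/2}`, locally integrable in the plane), while `∫ h dμ_ε → ∫ h dμ` by
Lévy's convergence theorem (Mathlib `ProbabilityMeasure.tendsto_iff_tendsto_charFun`); so
`∫ h dμ = ∫ h g_φ` on `C_c(ℂ)`, `g_φ ≥ 0` off `0`, `∫ g_φ ≤ 1`, and two regular measures with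
the same integrals on `C_c` coincide (Mathlib `Measure.ext_of_integral_eq_on_compactlySupported`).

## References

* E. M. Stein, G. Weiss, *Introduction to Fourier Analysis on Euclidean Spaces* (1971), Ch. IV
  Thm 3.3; S. Bochner, *Lectures on Fourier Integrals*, §44 (Abel–Gauss summability of the
  inversion integral); folklore in this form.
* J. C. Kluyver, A local probability problem, Proc. KNAW 8 (1905) 341–350 (the case `φ = J₀ⁿ`).
-/

noncomputable section

open _root_.MeasureTheory _root_.Set _root_.Real _root_.Complex _root_.Filter _root_.Metric
open _root_.ProbabilityTheory
open scoped ENNReal RealInnerProductSpace Topology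
open Literature.Analysis.FunctionSpaces

namespace Literature.Probability.Distributions

variable {μ : Measure ℂ} {φ : ℝ → ℝ}

/-! ### The Hankel density and its majorant -/

/-- **The order-`0` Hankel density** of a radial profile `φ`:
`g_φ(z) = (2π)⁻¹ ∫₀^∞ r φ(r) J₀(r‖z‖) dr` (absolutely convergent for `z ≠ 0` under (H); at `z = 0`
the value is Lean's junk `0` whenever `r φ(r) ∉ L¹`). [folklore] -/
def hankelDensity (φ : ℝ → ℝ) (z : ℂ) : ℝ :=
  (2 * π)⁻¹ * ∫ r in Ioi (0 : ℝ), r * besselJ 0 (r * ‖z‖) * φ r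

/-- Unfolding lemma. [folklore] -/
theorem hankelDensity_def (φ : ℝ → ℝ) (z : ℂ) :
    hankelDensity φ z = (2 * π)⁻¹ * ∫ r in Ioi (0 : ℝ), r * besselJ 0 (r * ‖z‖) * φ r := rfl

/-- `g_φ` is radial. [folklore] -/
theorem hankelDensity_ofReal_norm (φ : ℝ → ℝ) (z : ℂ) :
    hankelDensity φ (‖z‖ : ℂ) = hankelDensity φ z := by
  simp only [hankelDensity, Complex.norm_real, norm_norm]

/-- **`|J₀(x)| ≤ C x^{−1/2}` for all `x > 0`** (the tree's `|J₀| ≤ 1` and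
`|J₀(x)| ≤ C x^{−1/2}`, `x ≥ 1`). [folklore] -/
theorem exists_abs_besselJ_zero_le_rpow :
    ∃ C : ℝ, 0 < C ∧ ∀ x : ℝ, 0 < x → |besselJ 0 x| ≤ C * x ^ (-(1 / 2 : ℝ)) := by
  obtain ⟨C, hC⟩ := abs_besselJ_le_mul_rpow_neg_half 0
  refine ⟨max C 1, by positivity, fun x hx => ?_⟩
  have hxr : 0 ≤ x ^ (-(1 / 2 : ℝ)) := Real.rpow_nonneg hx.le _
  rcases le_or_gt 1 x with h1 | h1
  · have h := hC x (by push_cast; linarith)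
    calc |besselJ 0 x| ≤ C * x ^ (-(1 / 2 : ℝ)) := h
      _ ≤ max C 1 * x ^ (-(1 / 2 : ℝ)) := mul_le_mul_of_nonneg_right (le_max_left _ _) hxr
  · have h2 : (1 : ℝ) ≤ x ^ (-(1 / 2 : ℝ)) := by
      rw [Real.rpow_neg hx.le, one_le_inv_iff₀]
      exact ⟨Real.rpow_pos_of_pos hx _, Real.rpow_le_one hx.le h1.le (by norm_num)⟩
    calc |besselJ 0 x| ≤ 1 := abs_besselJ_zero_le_one_holds x
      _ ≤ max C 1 * 1 := by simp
      _ ≤ max C 1 * x ^ (-(1 / 2 : ℝ)) := mul_le_mul_of_nonneg_left h2 (by positivity)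

/-- `r (rs)^{−1/2} = √r · s^{−1/2}` for `r, s > 0`. [folklore] -/
theorem mul_rpow_mul_neg_half {r s : ℝ} (hr : 0 < r) (hs : 0 < s) :
    r * (r * s) ^ (-(1 / 2 : ℝ)) = Real.sqrt r * s ^ (-(1 / 2 : ℝ)) := by
  rw [Real.mul_rpow hr.le hs.le, ← mul_assoc]
  congr 1
  rw [Real.sqrt_eq_rpow, show r * r ^ (-(1 / 2 : ℝ)) = r ^ (1 : ℝ) * r ^ (-(1 / 2 : ℝ)) by
    rw [Real.rpow_one], ← Real.rpow_add hr]
  norm_num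

/-- The Hankel integrand is continuous in `r`. [folklore] -/
theorem continuous_hankelIntegrand (hφc : Continuous φ) (s : ℝ) :
    Continuous fun r : ℝ => r * besselJ 0 (r * s) * φ r :=
  (continuous_id.mul ((continuous_besselJ_holds 0).comp (continuous_id.mul continuous_const))).mul
    hφc

/-- **The majorant**: if `|J₀(x)| ≤ C x^{−1/2}` (`x > 0`) and `|ψ| ≤ |φ|` on `(0,∞)`, then for
`r, s > 0`, `|r J₀(rs) ψ(r)| ≤ C s^{−1/2} · |√r φ(r)|`. [folklore] -/
theorem abs_hankelIntegrand_le {C : ℝ} (hC : ∀ x : ℝ, 0 < x → |besselJ 0 x| ≤ C * x ^ (-(1 / 2 : ℝ)))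
    {ψ : ℝ → ℝ} (hψ : ∀ r, 0 < r → |ψ r| ≤ |φ r|) {r s : ℝ} (hr : 0 < r) (hs : 0 < s) :
    |r * besselJ 0 (r * s) * ψ r| ≤ C * s ^ (-(1 / 2 : ℝ)) * |Real.sqrt r * φ r| := by
  have hC0 : 0 ≤ C := by
    have := (abs_nonneg _).trans (hC 1 one_pos)
    simpa using this
  rw [abs_mul, abs_mul, abs_of_pos hr, abs_mul, abs_of_nonneg (Real.sqrt_nonneg r)]
  have hJ := hC (r * s) (by positivity)
  calc r * |besselJ 0 (r * s)| * |ψ r| ≤ r * (C * (r * s) ^ (-(1 / 2 : ℝ))) * |φ r| :=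
        mul_le_mul (mul_le_mul_of_nonneg_left hJ hr.le) (hψ r hr) (abs_nonneg _) (by positivity)
    _ = C * s ^ (-(1 / 2 : ℝ)) * (Real.sqrt r * |φ r|) := by
        rw [show r * (C * (r * s) ^ (-(1 / 2 : ℝ))) = C * (r * (r * s) ^ (-(1 / 2 : ℝ))) by ring,
          mul_rpow_mul_neg_half hr hs]
        ring

/-- **Absolute convergence of the Hankel integral off the origin** under (H), for every profile
`ψ` dominated by `φ`. [folklore] -/
theorem integrableOn_hankelIntegrand (hφ : IntegrableOn (fun r => Real.sqrt r * φ r) (Ioi 0))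
    {ψ : ℝ → ℝ} (hψc : Continuous ψ) (hψ : ∀ r, 0 < r → |ψ r| ≤ |φ r|) {s : ℝ} (hs : 0 < s) :
    IntegrableOn (fun r : ℝ => r * besselJ 0 (r * s) * ψ r) (Ioi 0) := by
  obtain ⟨C, -, hC⟩ := exists_abs_besselJ_zero_le_rpow
  refine Integrable.mono' (hφ.norm.const_mul (C * s ^ (-(1 / 2 : ℝ))))
    (continuous_hankelIntegrand hψc s).aestronglyMeasurable ?_
  filter_upwards [ae_restrict_mem measurableSet_Ioi] with r hr
  rw [Real.norm_eq_abs, Real.norm_eq_abs]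
  exact abs_hankelIntegrand_le hC hψ hr hs

/-- **The bound `|g_ψ(z)| ≤ B ‖z‖^{−1/2}`** off the origin, uniformly over profiles `ψ` dominated by
`φ`, with `B = (2π)⁻¹ C ‖√r φ‖_{L¹(0,∞)}`. [folklore] -/
theorem abs_hankelDensity_le {C : ℝ} (hC : ∀ x : ℝ, 0 < x → |besselJ 0 x| ≤ C * x ^ (-(1 / 2 : ℝ)))
    (hφ : IntegrableOn (fun r => Real.sqrt r * φ r) (Ioi 0))
    {ψ : ℝ → ℝ} (hψc : Continuous ψ) (hψ : ∀ r, 0 < r → |ψ r| ≤ |φ r|) {z : ℂ} (hz : z ≠ 0) :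
    |hankelDensity ψ z| ≤
      (2 * π)⁻¹ * (C * ∫ r in Ioi (0 : ℝ), |Real.sqrt r * φ r|) * ‖z‖ ^ (-(1 / 2 : ℝ)) := by
  have hs : 0 < ‖z‖ := norm_pos_iff.mpr hz
  rw [hankelDensity, abs_mul, abs_of_pos (by positivity : (0 : ℝ) < (2 * π)⁻¹), mul_assoc]
  refine mul_le_mul_of_nonneg_left ?_ (by positivity)
  calc |∫ r in Ioi (0 : ℝ), r * besselJ 0 (r * ‖z‖) * ψ r|
      ≤ ∫ r in Ioi (0 : ℝ), |r * besselJ 0 (r * ‖z‖) * ψ r| := abs_integral_le_integral_abs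
    _ ≤ ∫ r in Ioi (0 : ℝ), C * ‖z‖ ^ (-(1 / 2 : ℝ)) * |Real.sqrt r * φ r| := by
        refine setIntegral_mono_on (integrableOn_hankelIntegrand hφ hψc hψ hs).abs
          ((hφ.abs.const_mul _)) measurableSet_Ioi fun r hr => ?_
        exact abs_hankelIntegrand_le hC hψ hr hs
    _ = C * (∫ r in Ioi (0 : ℝ), |Real.sqrt r * φ r|) * ‖z‖ ^ (-(1 / 2 : ℝ)) := by
        rw [integral_const_mul]; ring

/-- **Continuity of `g_ψ` off the origin** (dominated convergence, majorant at `‖z‖ ≥ ‖z₀‖/2`).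
[folklore] -/
theorem continuousOn_hankelDensity (hφ : IntegrableOn (fun r => Real.sqrt r * φ r) (Ioi 0))
    {ψ : ℝ → ℝ} (hψc : Continuous ψ) (hψ : ∀ r, 0 < r → |ψ r| ≤ |φ r|) :
    ContinuousOn (hankelDensity ψ) {0}ᶜ := by
  obtain ⟨C, -, hC⟩ := exists_abs_besselJ_zero_le_rpow
  intro z₀ hz₀
  rw [mem_compl_iff, mem_singleton_iff] at hz₀
  have hs₀ : 0 < ‖z₀‖ := norm_pos_iff.mpr hz₀
  refine ContinuousAt.continuousWithinAt ?_
  unfold hankelDensity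
  refine ContinuousAt.mul continuousAt_const ?_
  -- dominated convergence on the neighbourhood `‖z‖ > ‖z₀‖/2`
  have hU : {z : ℂ | ‖z₀‖ / 2 < ‖z‖} ∈ 𝓝 z₀ :=
    (isOpen_lt continuous_const continuous_norm).mem_nhds (by
      simp only [mem_setOf_eq]; linarith)
  refine continuousAt_of_dominated (bound := fun r => C * (‖z₀‖ / 2) ^ (-(1 / 2 : ℝ)) *
      |Real.sqrt r * φ r|) ?_ ?_ ?_ ?_
  · exact Eventually.of_forall fun z => (continuous_hankelIntegrand hψc ‖z‖).aestronglyMeasurable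
  · filter_upwards [hU] with z hz
    filter_upwards [ae_restrict_mem measurableSet_Ioi] with r hr
    rw [Real.norm_eq_abs]
    have hz' : ‖z₀‖ / 2 < ‖z‖ := hz
    have hs : 0 < ‖z‖ := by linarith
    refine (abs_hankelIntegrand_le hC hψ hr hs).trans ?_
    have hC0 : 0 ≤ C := by have := (abs_nonneg _).trans (hC 1 one_pos); simpa using this
    have hmono : ‖z‖ ^ (-(1 / 2 : ℝ)) ≤ (‖z₀‖ / 2) ^ (-(1 / 2 : ℝ)) :=
      Real.rpow_le_rpow_of_nonpos (by positivity) hz'.le (by norm_num)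
    gcongr
  · exact (hφ.abs.const_mul _)
  · refine Eventually.of_forall fun r => ?_
    exact ((continuous_const.mul ((continuous_besselJ_holds 0).comp
      (continuous_const.mul continuous_norm))).mul continuous_const).continuousAt

/-- `g_ψ` is (strongly) measurable (a parametric integral of a jointly continuous integrand).
[folklore] -/
theorem stronglyMeasurable_hankelDensity {ψ : ℝ → ℝ} (hψc : Continuous ψ) :
    StronglyMeasurable (hankelDensity ψ) := by
  unfold hankelDensity
  refine stronglyMeasurable_const.mul ?_
  have hF : Continuous (Function.uncurry fun (z : ℂ) (r : ℝ) => r * besselJ 0 (r * ‖z‖) * ψ r) := by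
    refine ((continuous_snd).mul ((continuous_besselJ_holds 0).comp
      (continuous_snd.mul (continuous_norm.comp continuous_fst)))).mul (hψc.comp continuous_snd)
  exact hF.stronglyMeasurable.integral_prod_right' (ν := volume.restrict (Ioi (0 : ℝ)))

/-! ### Local integrability of `‖z‖^{−1/2}` in the plane -/

/-- `z ↦ ‖z‖^{−1/2}` is integrable on every closed ball of `ℂ ≅ ℝ²` (polar coordinates:
`∫₀^R r · r^{−1/2} dr < ∞`). [folklore] -/
theorem integrableOn_norm_rpow_neg_half_closedBall (R : ℝ) :
    IntegrableOn (fun z : ℂ => ‖z‖ ^ (-(1 / 2 : ℝ))) (closedBall 0 R) := by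
  -- as a radial function `f(‖z‖)` on the whole plane
  set f : ℝ → ℝ := fun y => if y ≤ R then y ^ (-(1 / 2 : ℝ)) else 0 with hf
  have hrad : (closedBall (0 : ℂ) R).indicator (fun z : ℂ => ‖z‖ ^ (-(1 / 2 : ℝ))) =
      fun z : ℂ => f ‖z‖ := by
    funext z
    by_cases hz : ‖z‖ ≤ R
    · rw [indicator_of_mem (mem_closedBall_zero_iff.mpr hz)]
      simp only [hf, if_pos hz]
    · rw [indicator_of_notMem (fun h => hz (mem_closedBall_zero_iff.mp h))]
      simp only [hf, if_neg hz]
  rw [← integrable_indicator_iff measurableSet_closedBall, hrad]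
  refine (integrable_fun_norm_addHaar (volume : Measure ℂ) (f := f)).2 ?_
  simp only [Complex.finrank_real_complex, Nat.add_one_sub_one, pow_one, smul_eq_mul]
  -- `y • f y = y^{1/2}` on `(0, R]`, `0` beyond
  have hg : IntegrableOn (fun y : ℝ => y ^ (1 / 2 : ℝ)) (Ioc 0 R) :=
    ((Real.continuous_rpow_const (by norm_num)).continuousOn.integrableOn_compact
      isCompact_Icc).mono_set Ioc_subset_Icc_self
  have hg' : IntegrableOn (fun y : ℝ => (Ioc 0 R).indicator (fun y => y ^ (1 / 2 : ℝ)) y) (Ioi 0) :=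
    (hg.integrable_indicator measurableSet_Ioc).integrableOn
  refine hg'.congr_fun (fun y hy => ?_) measurableSet_Ioi
  have hy0 : 0 < y := hy
  show (Ioc 0 R).indicator (fun y : ℝ => y ^ (1 / 2 : ℝ)) y = y * f y
  by_cases hyR : y ≤ R
  · rw [indicator_of_mem (show y ∈ Ioc 0 R from ⟨hy0, hyR⟩)]
    simp only [hf, if_pos hyR]
    rw [show y * y ^ (-(1 / 2 : ℝ)) = y ^ (1 : ℝ) * y ^ (-(1 / 2 : ℝ)) by rw [Real.rpow_one],
      ← Real.rpow_add hy0]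
    norm_num
  · rw [indicator_of_notMem (fun h : y ∈ Ioc 0 R => hyR h.2)]
    simp only [hf, if_neg hyR, mul_zero]

/-! ### Gaussian damping -/

/-- The Gaussian-damped profile `φ_ε(r) = φ(r) e^{−ε²r²/2}`. [folklore] -/
def gaussDamp (φ : ℝ → ℝ) (ε : ℝ) (r : ℝ) : ℝ := φ r * Real.exp (-(ε * r) ^ 2 / 2)

/-- `φ_ε` is continuous. [folklore] -/
theorem continuous_gaussDamp (hφc : Continuous φ) (ε : ℝ) : Continuous (gaussDamp φ ε) := by
  unfold gaussDamp; fun_prop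

/-- `|φ_ε| ≤ |φ|`. [folklore] -/
theorem abs_gaussDamp_le (φ : ℝ → ℝ) (ε r : ℝ) : |gaussDamp φ ε r| ≤ |φ r| := by
  unfold gaussDamp
  rw [abs_mul, abs_of_pos (Real.exp_pos _)]
  refine mul_le_of_le_one_right (abs_nonneg _) ?_
  rw [Real.exp_le_one_iff]
  have : 0 ≤ (ε * r) ^ 2 := sq_nonneg _
  linarith

/-- `φ_ε → φ` pointwise as `ε → 0` along `ε_n = (n+1)⁻¹`. [folklore] -/
theorem tendsto_gaussDamp (φ : ℝ → ℝ) (r : ℝ) :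
    Tendsto (fun n : ℕ => gaussDamp φ ((n : ℝ) + 1)⁻¹ r) atTop (𝓝 (φ r)) := by
  unfold gaussDamp
  have h1 : Tendsto (fun n : ℕ => ((n : ℝ) + 1)⁻¹) atTop (𝓝 0) :=
    tendsto_inv_atTop_zero.comp (tendsto_natCast_atTop_atTop.atTop_add tendsto_const_nhds)
  have h2 : Tendsto (fun n : ℕ => Real.exp (-((((n : ℝ) + 1)⁻¹) * r) ^ 2 / 2)) atTop (𝓝 1) := by
    have : Tendsto (fun n : ℕ => -((((n : ℝ) + 1)⁻¹) * r) ^ 2 / 2) atTop (𝓝 (-(0 * r) ^ 2 / 2)) :=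
      (((h1.mul_const r).pow 2).neg).div_const 2
    rw [zero_mul, zero_pow two_ne_zero, neg_zero, zero_div] at this
    simpa [Function.comp_def] using (Real.continuous_exp.tendsto 0).comp this
  simpa using (tendsto_const_nhds (x := φ r)).mul h2

/-- **`μ_ε = μ ∗ N(0, ε² I)`**: the law of `X + εG`, `X ∼ μ`, `G` a standard Gaussian vector of
the plane (Mathlib's `stdGaussian ℂ`). [folklore] -/
def gaussConv (μ : Measure ℂ) (ε : ℝ) : Measure ℂ :=
  μ ∗ (stdGaussian ℂ).map (fun z : ℂ => ε • z)

/-- `N(0, ε²I)` is a probability measure. [folklore] -/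
instance isProbabilityMeasure_map_smul_stdGaussian (ε : ℝ) :
    IsProbabilityMeasure ((stdGaussian ℂ).map (fun z : ℂ => ε • z)) :=
  Measure.isProbabilityMeasure_map (by fun_prop)

/-- `μ_ε` is a probability measure. [folklore] -/
instance isProbabilityMeasure_gaussConv [IsProbabilityMeasure μ] (ε : ℝ) :
    IsProbabilityMeasure (gaussConv μ ε) := by
  unfold gaussConv; infer_instance

/-- **The characteristic function of `μ_ε`**: `charFun μ_ε (ξ) = charFun μ (ξ) · e^{−ε²‖ξ‖²/2}`.
[folklore] -/
theorem charFun_gaussConv [IsProbabilityMeasure μ] (ε : ℝ) (ξ : ℂ) :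
    charFun (gaussConv μ ε) ξ = charFun μ ξ * Real.exp (-(ε * ‖ξ‖) ^ 2 / 2) := by
  unfold gaussConv
  rw [charFun_conv, charFun_map_smul, charFun_stdGaussian, norm_smul, Real.norm_eq_abs]
  congr 1
  have h : (|ε| * ‖ξ‖) ^ 2 = (ε * ‖ξ‖) ^ 2 := by rw [mul_pow, mul_pow, sq_abs]
  have h' : ((((|ε| * ‖ξ‖) ^ 2 : ℝ)) : ℂ) = ((((ε * ‖ξ‖) ^ 2 : ℝ)) : ℂ) := by rw [h]
  rw [Complex.ofReal_exp]
  push_cast at h' ⊢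
  rw [h']

/-- With a radial profile: `charFun μ_ε (ξ) = φ_ε(‖ξ‖)`. [folklore] -/
theorem charFun_gaussConv_of_radial [IsProbabilityMeasure μ] (hμ : ∀ ξ : ℂ, charFun μ ξ = φ ‖ξ‖)
    (ε : ℝ) (ξ : ℂ) : charFun (gaussConv μ ε) ξ = (gaussDamp φ ε ‖ξ‖ : ℝ) := by
  rw [charFun_gaussConv, hμ, gaussDamp]
  push_cast
  ring

/-- `|φ(r)| ≤ 1` for `r ≥ 0` when `φ(‖ξ‖)` is the characteristic function of a probability
measure. [folklore] -/
theorem abs_profile_le_one [IsProbabilityMeasure μ] (hμ : ∀ ξ : ℂ, charFun μ ξ = φ ‖ξ‖) {r : ℝ}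
    (hr : 0 ≤ r) : |φ r| ≤ 1 := by
  have h := norm_charFun_le_one (μ := μ) (r : ℂ)
  rw [hμ, Complex.norm_real, Complex.norm_real, Real.norm_of_nonneg hr, Real.norm_eq_abs] at h
  exact h

/-- For `ε ≠ 0`, `r φ_ε(r) ∈ L¹(0, ∞)` (Gaussian decay; `|φ| ≤ 1`), so `CharFunInversionRadial.lean`
applies to `μ_ε`. [folklore] -/
theorem integrableOn_mul_gaussDamp [IsProbabilityMeasure μ] (hμ : ∀ ξ : ℂ, charFun μ ξ = φ ‖ξ‖)
    (hφc : Continuous φ) {ε : ℝ} (hε : ε ≠ 0) :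
    IntegrableOn (fun r : ℝ => r * gaussDamp φ ε r) (Ioi 0) := by
  have hb : 0 < ε ^ 2 / 2 := by positivity
  have hint : Integrable (fun r : ℝ => r * Real.exp (-(ε ^ 2 / 2) * r ^ 2)) :=
    integrable_mul_exp_neg_mul_sq hb
  refine Integrable.mono' hint.integrableOn.norm
    ((continuous_id.mul (continuous_gaussDamp hφc ε)).aestronglyMeasurable) ?_
  filter_upwards [ae_restrict_mem measurableSet_Ioi] with r hr
  have hr0 : 0 < r := hr
  rw [Real.norm_eq_abs, Real.norm_eq_abs, abs_mul, abs_of_pos hr0, gaussDamp, abs_mul,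
    abs_of_pos (Real.exp_pos _), abs_mul, abs_of_pos hr0, abs_of_pos (Real.exp_pos _)]
  have h1 := abs_profile_le_one hμ hr0.le
  have he : Real.exp (-(ε * r) ^ 2 / 2) = Real.exp (-(ε ^ 2 / 2) * r ^ 2) := by
    congr 1; ring
  rw [he]
  calc r * (|φ r| * Real.exp (-(ε ^ 2 / 2) * r ^ 2)) ≤ r * (1 * Real.exp (-(ε ^ 2 / 2) * r ^ 2)) := by
        gcongr
    _ = r * Real.exp (-(ε ^ 2 / 2) * r ^ 2) := by ring

/-- **`μ_ε` has the continuous density `g_{φ_ε}`** (`CharFunInversionRadial.lean`). [folklore] -/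
theorem gaussConv_eq_withDensity [IsProbabilityMeasure μ] (hμ : ∀ ξ : ℂ, charFun μ ξ = φ ‖ξ‖)
    (hφc : Continuous φ) {ε : ℝ} (hε : ε ≠ 0) :
    gaussConv μ ε =
      volume.withDensity (fun z => ENNReal.ofReal (hankelDensity (gaussDamp φ ε) z)) := by
  have hrad := charFun_gaussConv_of_radial hμ ε
  have hint := integrableOn_mul_gaussDamp hμ hφc hε
  rw [eq_withDensity_fourierDensity_of_charFun_radial hrad hint]
  congr 1
  funext z
  rw [fourierDensity_eq_hankel_of_charFun_radial hrad (continuous_gaussDamp hφc ε) hint z,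
    hankelDensity]

/-- `g_{φ_ε} ≥ 0`. [folklore] -/
theorem hankelDensity_gaussDamp_nonneg [IsProbabilityMeasure μ]
    (hμ : ∀ ξ : ℂ, charFun μ ξ = φ ‖ξ‖) (hφc : Continuous φ) {ε : ℝ} (hε : ε ≠ 0) (z : ℂ) :
    0 ≤ hankelDensity (gaussDamp φ ε) z := by
  have hrad := charFun_gaussConv_of_radial hμ ε
  have hint := integrableOn_mul_gaussDamp hμ hφc hε
  have h := fourierDensity_nonneg (integrable_charFun_iff.1 (integrable_charFun_of_radial hrad hint)) z
  rwa [fourierDensity_eq_hankel_of_charFun_radial hrad (continuous_gaussDamp hφc ε) hint z,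
    ← hankelDensity_def] at h

/-- **`∫ h dμ_ε = ∫ h g_{φ_ε}`** for `h ∈ C_c(ℂ)`. [folklore] -/
theorem integral_gaussConv_eq [IsProbabilityMeasure μ] (hμ : ∀ ξ : ℂ, charFun μ ξ = φ ‖ξ‖)
    (hφc : Continuous φ) {ε : ℝ} (hε : ε ≠ 0) {h : ℂ → ℝ} (hh : Continuous h)
    (hsupp : HasCompactSupport h) :
    ∫ z, h z ∂(gaussConv μ ε) = ∫ z, h z * hankelDensity (gaussDamp φ ε) z := by
  have hrad := charFun_gaussConv_of_radial hμ ε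
  have hint := integrableOn_mul_gaussDamp hμ hφc hε
  have hL1 := integrable_charFun_iff.1 (integrable_charFun_of_radial hrad hint)
  rw [← integral_mul_fourierDensity hL1 hh hsupp]
  congr 1
  funext z
  rw [fourierDensity_eq_hankel_of_charFun_radial hrad (continuous_gaussDamp hφc ε) hint z,
    hankelDensity]

/-! ### The two limits -/

/-- **`g_{φ_ε}(z) → g_φ(z)` for `z ≠ 0`** along `ε_n = (n+1)⁻¹` (dominated convergence with the
majorant `C‖z‖^{−1/2} √r|φ(r)|`). [folklore] -/
theorem tendsto_hankelDensity_gaussDamp (hφc : Continuous φ)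
    (hφ : IntegrableOn (fun r => Real.sqrt r * φ r) (Ioi 0)) {z : ℂ} (hz : z ≠ 0) :
    Tendsto (fun n : ℕ => hankelDensity (gaussDamp φ ((n : ℝ) + 1)⁻¹) z) atTop
      (𝓝 (hankelDensity φ z)) := by
  obtain ⟨C, -, hC⟩ := exists_abs_besselJ_zero_le_rpow
  have hs : 0 < ‖z‖ := norm_pos_iff.mpr hz
  unfold hankelDensity
  refine Tendsto.const_mul _ ?_
  refine tendsto_integral_of_dominated_convergence
    (fun r => C * ‖z‖ ^ (-(1 / 2 : ℝ)) * |Real.sqrt r * φ r|) ?_ ?_ ?_ ?_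
  · exact fun n => (continuous_hankelIntegrand (continuous_gaussDamp hφc _) ‖z‖).aestronglyMeasurable
  · exact hφ.abs.const_mul _
  · intro n
    filter_upwards [ae_restrict_mem measurableSet_Ioi] with r hr
    rw [Real.norm_eq_abs]
    exact abs_hankelIntegrand_le hC (fun r _ => abs_gaussDamp_le φ _ r) hr hs
  · refine Eventually.of_forall fun r => ?_
    exact (tendsto_const_nhds (x := r * besselJ 0 (r * ‖z‖))).mul (tendsto_gaussDamp φ r)

/-- **`∫ h g_{φ_ε} → ∫ h g_φ`** for `h ∈ C_c(ℂ)` (dominated convergence in the plane, majorant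
`‖h‖_∞ B‖z‖^{−1/2}` on the support). [folklore] -/
theorem tendsto_integral_mul_hankelDensity_gaussDamp (hφc : Continuous φ)
    (hφ : IntegrableOn (fun r => Real.sqrt r * φ r) (Ioi 0)) {h : ℂ → ℝ} (hh : Continuous h)
    (hsupp : HasCompactSupport h) :
    Tendsto (fun n : ℕ => ∫ z, h z * hankelDensity (gaussDamp φ ((n : ℝ) + 1)⁻¹) z) atTop
      (𝓝 (∫ z, h z * hankelDensity φ z)) := by
  obtain ⟨C, -, hC⟩ := exists_abs_besselJ_zero_le_rpow
  obtain ⟨M, hM⟩ := hsupp.exists_bound_of_continuous hh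
  obtain ⟨R, hR⟩ := hsupp.isCompact.isBounded.subset_closedBall 0
  set B : ℝ := (2 * π)⁻¹ * (C * ∫ r in Ioi (0 : ℝ), |Real.sqrt r * φ r|) with hB
  have hB0 : 0 ≤ B := by
    have hC0 : 0 ≤ C := by have := (abs_nonneg _).trans (hC 1 one_pos); simpa using this
    positivity
  refine tendsto_integral_of_dominated_convergence
    (fun z => M * (closedBall (0 : ℂ) R).indicator (fun z => B * ‖z‖ ^ (-(1 / 2 : ℝ))) z) ?_ ?_ ?_ ?_
  · intro n
    exact (hh.aestronglyMeasurable.mul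
      (stronglyMeasurable_hankelDensity (continuous_gaussDamp hφc _)).aestronglyMeasurable)
  · refine Integrable.const_mul ?_ M
    have hI : IntegrableOn (fun z : ℂ => B * ‖z‖ ^ (-(1 / 2 : ℝ))) (closedBall 0 R) :=
      (integrableOn_norm_rpow_neg_half_closedBall R).const_mul B
    exact hI.integrable_indicator measurableSet_closedBall
  · intro n
    have h0 : ∀ᵐ z : ℂ ∂volume, z ≠ 0 := by
      rw [ae_iff]
      simp
    filter_upwards [h0] with z hz
    rw [norm_mul, Real.norm_eq_abs, Real.norm_eq_abs]
    by_cases hzs : z ∈ tsupport h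
    · have hzR : z ∈ closedBall (0 : ℂ) R := hR hzs
      rw [indicator_of_mem hzR]
      have h1 := abs_hankelDensity_le hC hφ (continuous_gaussDamp hφc (((n : ℝ) + 1)⁻¹))
        (fun r _ => abs_gaussDamp_le φ _ r) hz
      calc |h z| * |hankelDensity (gaussDamp φ ((n : ℝ) + 1)⁻¹) z|
          ≤ M * (B * ‖z‖ ^ (-(1 / 2 : ℝ))) := by
            refine mul_le_mul (by simpa using hM z) h1 (abs_nonneg _) ((norm_nonneg _).trans (hM z))
        _ = M * (B * ‖z‖ ^ (-(1 / 2 : ℝ))) := rfl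
    · have : h z = 0 := image_eq_zero_of_notMem_tsupport hzs
      rw [this, abs_zero, zero_mul]
      exact mul_nonneg ((norm_nonneg _).trans (hM 0)) (indicator_nonneg (fun w _ => by positivity) _)
  · have h0 : ∀ᵐ z : ℂ ∂volume, z ≠ 0 := by
      rw [ae_iff]
      simp
    filter_upwards [h0] with z hz
    exact (tendsto_hankelDensity_gaussDamp hφc hφ hz).const_mul (h z)

/-- A probability measure on `ℂ`, bundled (for Mathlib's topology of weak convergence). [folklore] -/
def probMeasure (μ : Measure ℂ) [IsProbabilityMeasure μ] : ProbabilityMeasure ℂ := ⟨μ, inferInstance⟩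

/-- The underlying measure of `probMeasure μ` is `μ`. [folklore] -/
@[simp] theorem coe_probMeasure (μ : Measure ℂ) [IsProbabilityMeasure μ] :
    ((probMeasure μ : ProbabilityMeasure ℂ) : Measure ℂ) = μ := rfl

/-- **`μ_{ε_n} → μ` weakly** (Lévy's convergence theorem: the characteristic functions converge
pointwise). [folklore] -/
theorem tendsto_gaussConv [IsProbabilityMeasure μ] :
    Tendsto (fun n : ℕ => probMeasure (gaussConv μ ((n : ℝ) + 1)⁻¹)) atTop (𝓝 (probMeasure μ)) := by
  refine ProbabilityMeasure.tendsto_of_tendsto_charFun fun ξ => ?_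
  simp only [coe_probMeasure, charFun_gaussConv]
  have h1 : Tendsto (fun n : ℕ => ((n : ℝ) + 1)⁻¹) atTop (𝓝 0) :=
    tendsto_inv_atTop_zero.comp (tendsto_natCast_atTop_atTop.atTop_add tendsto_const_nhds)
  have h2 : Tendsto (fun n : ℕ => Real.exp (-((((n : ℝ) + 1)⁻¹) * ‖ξ‖) ^ 2 / 2)) atTop (𝓝 1) := by
    have : Tendsto (fun n : ℕ => -((((n : ℝ) + 1)⁻¹) * ‖ξ‖) ^ 2 / 2) atTop
        (𝓝 (-(0 * ‖ξ‖) ^ 2 / 2)) := (((h1.mul_const ‖ξ‖).pow 2).neg).div_const 2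
    rw [zero_mul, zero_pow two_ne_zero, neg_zero, zero_div] at this
    simpa [Function.comp_def] using (Real.continuous_exp.tendsto 0).comp this
  have h3 : Tendsto (fun n : ℕ => ((Real.exp (-((((n : ℝ) + 1)⁻¹) * ‖ξ‖) ^ 2 / 2) : ℝ) : ℂ))
      atTop (𝓝 ((1 : ℝ) : ℂ)) := (Complex.continuous_ofReal.tendsto 1).comp h2
  simpa using (tendsto_const_nhds (x := charFun μ ξ)).mul h3

/-- **`∫ h dμ_{ε_n} → ∫ h dμ`** for `h ∈ C_c(ℂ)`. [folklore] -/
theorem tendsto_integral_gaussConv [IsProbabilityMeasure μ] {h : ℂ → ℝ} (hh : Continuous h)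
    (hsupp : HasCompactSupport h) :
    Tendsto (fun n : ℕ => ∫ z, h z ∂(gaussConv μ ((n : ℝ) + 1)⁻¹)) atTop (𝓝 (∫ z, h z ∂μ)) := by
  obtain ⟨M, hM⟩ := hsupp.exists_bound_of_continuous hh
  exact (ProbabilityMeasure.tendsto_iff_forall_integral_tendsto.mp (tendsto_gaussConv (μ := μ)))
    (BoundedContinuousFunction.ofNormedAddCommGroup h hh M hM)

/-! ### The inversion theorem -/

/-- **`∫ h dμ = ∫ h g_φ` for every `h ∈ C_c(ℂ)`.** [folklore] -/
theorem integral_eq_integral_mul_hankelDensity [IsProbabilityMeasure μ]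
    (hμ : ∀ ξ : ℂ, charFun μ ξ = φ ‖ξ‖) (hφc : Continuous φ)
    (hφ : IntegrableOn (fun r => Real.sqrt r * φ r) (Ioi 0)) {h : ℂ → ℝ} (hh : Continuous h)
    (hsupp : HasCompactSupport h) :
    ∫ z, h z ∂μ = ∫ z, h z * hankelDensity φ z := by
  have L1 := tendsto_integral_gaussConv (μ := μ) hh hsupp
  have L2 := tendsto_integral_mul_hankelDensity_gaussDamp hφc hφ hh hsupp
  have heq : (fun n : ℕ => ∫ z, h z ∂(gaussConv μ ((n : ℝ) + 1)⁻¹)) =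
      fun n : ℕ => ∫ z, h z * hankelDensity (gaussDamp φ ((n : ℝ) + 1)⁻¹) z :=
    funext fun n => integral_gaussConv_eq hμ hφc (by positivity) hh hsupp
  rw [heq] at L1
  exact tendsto_nhds_unique L1 L2

/-- **`g_φ ≥ 0` off the origin** (pointwise limit of the densities `g_{φ_ε} ≥ 0`). [folklore] -/
theorem hankelDensity_nonneg [IsProbabilityMeasure μ] (hμ : ∀ ξ : ℂ, charFun μ ξ = φ ‖ξ‖)
    (hφc : Continuous φ) (hφ : IntegrableOn (fun r => Real.sqrt r * φ r) (Ioi 0)) {z : ℂ}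
    (hz : z ≠ 0) : 0 ≤ hankelDensity φ z :=
  ge_of_tendsto' (tendsto_hankelDensity_gaussDamp hφc hφ hz) fun n =>
    hankelDensity_gaussDamp_nonneg hμ hφc (by positivity) z


/-! ### `μ = g_φ · Lebesgue` -/

/-- Lebesgue-almost every point of the plane is `≠ 0`. [folklore] -/
theorem ae_ne_zero_volume : ∀ᵐ z : ℂ ∂volume, z ≠ 0 := by
  rw [ae_iff]
  simp

/-- `g_φ · Lebesgue` gives finite mass to closed balls (the majorant `B‖z‖^{−1/2}` is locally
integrable). [folklore] -/
theorem withDensity_hankelDensity_closedBall_lt_top (hφc : Continuous φ)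
    (hφ : IntegrableOn (fun r => Real.sqrt r * φ r) (Ioi 0)) (R : ℝ) :
    volume.withDensity (fun z => ENNReal.ofReal (hankelDensity φ z)) (closedBall 0 R) < ∞ := by
  obtain ⟨C, -, hC⟩ := exists_abs_besselJ_zero_le_rpow
  set B : ℝ := (2 * π)⁻¹ * (C * ∫ r in Ioi (0 : ℝ), |Real.sqrt r * φ r|) with hB
  rw [withDensity_apply _ measurableSet_closedBall]
  have hI : IntegrableOn (fun z : ℂ => B * ‖z‖ ^ (-(1 / 2 : ℝ))) (closedBall 0 R) :=
    (integrableOn_norm_rpow_neg_half_closedBall R).const_mul B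
  calc ∫⁻ z in closedBall 0 R, ENNReal.ofReal (hankelDensity φ z)
      ≤ ∫⁻ z in closedBall 0 R, ‖B * ‖z‖ ^ (-(1 / 2 : ℝ))‖ₑ := by
        refine lintegral_mono_ae ?_
        filter_upwards [ae_restrict_of_ae (s := closedBall (0 : ℂ) R) ae_ne_zero_volume] with z hz
        have h1 := abs_hankelDensity_le hC hφ hφc (fun r _ => le_rfl) hz
        rw [← ofReal_norm, Real.norm_eq_abs]
        exact ENNReal.ofReal_le_ofReal ((le_abs_self _).trans (h1.trans (le_abs_self _)))
    _ < ∞ := hI.2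

/-- Hence `g_φ · Lebesgue` is locally finite (so regular). [folklore] -/
theorem isLocallyFiniteMeasure_withDensity_hankelDensity (hφc : Continuous φ)
    (hφ : IntegrableOn (fun r => Real.sqrt r * φ r) (Ioi 0)) :
    IsLocallyFiniteMeasure (volume.withDensity (fun z : ℂ => ENNReal.ofReal (hankelDensity φ z))) := by
  refine ⟨fun x => ⟨closedBall 0 (‖x‖ + 1), ?_,
    withDensity_hankelDensity_closedBall_lt_top hφc hφ _⟩⟩
  refine Filter.mem_of_superset (ball_mem_nhds x one_pos) fun y hy => ?_
  rw [mem_ball_iff_norm] at hy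
  rw [mem_closedBall_zero_iff]
  calc ‖y‖ = ‖(y - x) + x‖ := by rw [sub_add_cancel]
    _ ≤ ‖y - x‖ + ‖x‖ := norm_add_le _ _
    _ ≤ ‖x‖ + 1 := by linarith

/-- **Hankel inversion beyond `L¹` (Gaussian damping).** If `μ` is a probability measure on the
plane with radial characteristic function `charFun μ ξ = φ(‖ξ‖)`, `φ` continuous with
`√r φ(r) ∈ L¹(0,∞)`, then `μ` is absolutely continuous with density
`g_φ(z) = (2π)⁻¹ ∫₀^∞ r φ(r) J₀(r‖z‖) dr` (`hankelDensity φ`, continuous and non-negative off the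
origin): `μ = g_φ · Lebesgue`. [folklore] -/
theorem eq_withDensity_hankelDensity [IsProbabilityMeasure μ] (hμ : ∀ ξ : ℂ, charFun μ ξ = φ ‖ξ‖)
    (hφc : Continuous φ) (hφ : IntegrableOn (fun r => Real.sqrt r * φ r) (Ioi 0)) :
    μ = volume.withDensity (fun z => ENNReal.ofReal (hankelDensity φ z)) := by
  haveI := isLocallyFiniteMeasure_withDensity_hankelDensity (φ := φ) hφc hφ
  have hmeas : Measurable fun z : ℂ => ENNReal.ofReal (hankelDensity φ z) :=
    ENNReal.measurable_ofReal.comp (stronglyMeasurable_hankelDensity hφc).measurable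
  refine Measure.ext_of_integral_eq_on_compactlySupported fun f => ?_
  have hfc : Continuous (f : ℂ → ℝ) := f.continuous
  have hfs : HasCompactSupport (f : ℂ → ℝ) := f.hasCompactSupport
  rw [integral_eq_integral_mul_hankelDensity hμ hφc hφ hfc hfs,
    integral_withDensity_eq_integral_toReal_smul hmeas
      (Eventually.of_forall fun _ => ENNReal.ofReal_lt_top)]
  refine integral_congr_ae ?_
  filter_upwards [ae_ne_zero_volume] with z hz
  rw [ENNReal.toReal_ofReal (hankelDensity_nonneg hμ hφc hφ hz), smul_eq_mul, mul_comm]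

/-- In particular `g_φ · Lebesgue` is a probability measure: `∫ g_φ = 1`. [folklore] -/
theorem lintegral_hankelDensity [IsProbabilityMeasure μ] (hμ : ∀ ξ : ℂ, charFun μ ξ = φ ‖ξ‖)
    (hφc : Continuous φ) (hφ : IntegrableOn (fun r => Real.sqrt r * φ r) (Ioi 0)) :
    ∫⁻ z, ENNReal.ofReal (hankelDensity φ z) = 1 := by
  have h := congrArg (fun ν : Measure ℂ => ν univ) (eq_withDensity_hankelDensity hμ hφc hφ)
  simp only [measure_univ, withDensity_apply _ MeasurableSet.univ, Measure.restrict_univ] at h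
  exact h.symm

/-! ### The law of `‖X‖` -/

/-- `x g_φ(x)` is integrable on `(0, b]` (bound `B√x`). [folklore] -/
theorem integrableOn_mul_hankelDensity (hφc : Continuous φ)
    (hφ : IntegrableOn (fun r => Real.sqrt r * φ r) (Ioi 0)) (b : ℝ) :
    IntegrableOn (fun x : ℝ => x * hankelDensity φ x) (Ioc 0 b) := by
  obtain ⟨C, -, hC⟩ := exists_abs_besselJ_zero_le_rpow
  set B : ℝ := (2 * π)⁻¹ * (C * ∫ r in Ioi (0 : ℝ), |Real.sqrt r * φ r|) with hB
  have hcont : ContinuousOn (fun x : ℝ => x * hankelDensity φ x) (Ioc 0 b) := by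
    refine continuousOn_id.mul ((continuousOn_hankelDensity hφ hφc (fun r _ => le_rfl)).comp
      Complex.continuous_ofReal.continuousOn fun x hx => ?_)
    rw [mem_compl_iff, mem_singleton_iff, Complex.ofReal_eq_zero]
    exact hx.1.ne'
  refine IntegrableOn.of_bound (by rw [Real.volume_Ioc]; exact ENNReal.ofReal_lt_top)
    (hcont.aestronglyMeasurable measurableSet_Ioc) (B * Real.sqrt b) ?_
  filter_upwards [ae_restrict_mem measurableSet_Ioc] with x hx
  have hx0 : 0 < x := hx.1
  have hz : (x : ℂ) ≠ 0 := Complex.ofReal_ne_zero.mpr hx0.ne'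
  have h1 := abs_hankelDensity_le hC hφ hφc (fun r _ => le_rfl) hz
  rw [Complex.norm_real, Real.norm_of_nonneg hx0.le] at h1
  rw [norm_mul, Real.norm_of_nonneg hx0.le, Real.norm_eq_abs]
  have hC0 : 0 ≤ C := by have := (abs_nonneg _).trans (hC 1 one_pos); simpa using this
  have hB0 : 0 ≤ B := by positivity
  calc x * |hankelDensity φ x| ≤ x * (B * x ^ (-(1 / 2 : ℝ))) :=
        mul_le_mul_of_nonneg_left h1 hx0.le
    _ = B * Real.sqrt x := by
        rw [Real.sqrt_eq_rpow, show x * (B * x ^ (-(1 / 2 : ℝ))) = B * (x ^ (1 : ℝ) * x ^ (-(1 / 2 : ℝ)))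
          by rw [Real.rpow_one]; ring, ← Real.rpow_add hx0]
        norm_num
    _ ≤ B * Real.sqrt b := mul_le_mul_of_nonneg_left (Real.sqrt_le_sqrt hx.2) hB0

/-- **The law of `‖X‖`** for `X ∼ μ` as above: density `p(x) = 2πx g_φ(x) = x ∫₀^∞ r φ(r) J₀(rx) dr`
on `(0, ∞)` (Kluyver's form). [folklore] -/
theorem map_norm_eq_withDensity_hankelDensity [IsProbabilityMeasure μ]
    (hμ : ∀ ξ : ℂ, charFun μ ξ = φ ‖ξ‖) (hφc : Continuous φ)
    (hφ : IntegrableOn (fun r => Real.sqrt r * φ r) (Ioi 0)) :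
    μ.map (fun z : ℂ => ‖z‖) =
      (volume.restrict (Ioi (0 : ℝ))).withDensity
        (fun x => ENNReal.ofReal (2 * π * x * hankelDensity φ x)) := by
  have hF0 : ∀ x : ℝ, 0 < x → 0 ≤ hankelDensity φ x := fun x hx =>
    hankelDensity_nonneg hμ hφc hφ (Complex.ofReal_ne_zero.mpr hx.ne')
  haveI : IsFiniteMeasure (μ.map fun z : ℂ => ‖z‖) := Measure.isFiniteMeasure_map μ _
  refine Measure.ext_of_Ioc _ _ fun a b hab => ?_
  set S : Set ℝ := Ioc a b ∩ Ioi 0 with hS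
  have hSm : MeasurableSet S := measurableSet_Ioc.inter measurableSet_Ioi
  -- integrability of `y g(y)` on `S`
  have hIntS : IntegrableOn (fun y : ℝ => y * hankelDensity φ y) S :=
    (integrableOn_mul_hankelDensity hφc hφ b).mono_set fun y hy => ⟨hy.2, hy.1.2⟩
  -- right-hand side
  rw [withDensity_apply _ measurableSet_Ioc, Measure.restrict_restrict measurableSet_Ioc]
  have hR : ∫⁻ x in S, ENNReal.ofReal (2 * π * x * hankelDensity φ x) =
      ENNReal.ofReal (∫ x in S, 2 * π * x * hankelDensity φ x) := by
    rw [ofReal_integral_eq_lintegral_ofReal]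
    · refine (hIntS.const_mul (2 * π)).congr ?_
      exact Filter.Eventually.of_forall fun x => by ring
    · refine ae_restrict_of_forall_mem hSm fun x hx => ?_
      have := hF0 x hx.2
      have : 0 < x := hx.2
      positivity
  rw [show Ioc a b ∩ Ioi 0 = S from rfl, hR, Measure.map_apply continuous_norm.measurable measurableSet_Ioc]
  -- left-hand side through the density
  conv_lhs => rw [eq_withDensity_hankelDensity hμ hφc hφ]
  rw [withDensity_apply _ (measurableSet_Ioc.preimage continuous_norm.measurable),
    ← lintegral_indicator (measurableSet_Ioc.preimage continuous_norm.measurable)]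
  set G : ℝ → ℝ := S.indicator fun y => hankelDensity φ y with hG
  have hGm : ∀ᵐ z : ℂ ∂volume, ((fun w : ℂ => ‖w‖) ⁻¹' Ioc a b).indicator
      (fun w => ENNReal.ofReal (hankelDensity φ w)) z = ENNReal.ofReal (G ‖z‖) := by
    filter_upwards [ae_ne_zero_volume] with z hz
    have hzpos : 0 < ‖z‖ := norm_pos_iff.mpr hz
    by_cases hmem : ‖z‖ ∈ Ioc a b
    · rw [indicator_of_mem (show z ∈ (fun w : ℂ => ‖w‖) ⁻¹' Ioc a b from hmem), hG,
        indicator_of_mem (show ‖z‖ ∈ S from ⟨hmem, hzpos⟩), hankelDensity_ofReal_norm]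
    · rw [indicator_of_notMem (show z ∉ (fun w : ℂ => ‖w‖) ⁻¹' Ioc a b from hmem), hG,
        indicator_of_notMem (fun h : ‖z‖ ∈ S => hmem h.1), ENNReal.ofReal_zero]
  rw [lintegral_congr_ae hGm]
  have hyG : (fun y : ℝ => y * G y) = S.indicator fun y => y * hankelDensity φ y := by
    funext y; simp only [hG, Set.indicator_apply]; split_ifs <;> simp
  have hGint : Integrable (fun z : ℂ => G ‖z‖) := by
    refine (integrable_fun_norm_addHaar (volume : Measure ℂ) (f := G)).2 ?_
    simp only [Complex.finrank_real_complex, Nat.add_one_sub_one, pow_one, smul_eq_mul]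
    rw [hyG, integrableOn_indicator_iff hSm]
    exact hIntS.mono_set inter_subset_left
  have hG0 : ∀ y, 0 ≤ G y := fun y => by
    simp only [hG, Set.indicator_apply]
    split_ifs with h
    · exact hF0 y h.2
    · exact le_rfl
  rw [← ofReal_integral_eq_lintegral_ofReal hGint (Filter.Eventually.of_forall fun z => hG0 _)]
  congr 1
  rw [integral_fun_norm_addHaar (volume : Measure ℂ) G, Complex.finrank_real_complex,
    Measure.real, Complex.volume_ball]
  simp only [ENNReal.ofReal_one, one_pow, one_mul, ENNReal.coe_toReal, NNReal.coe_real_pi,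
    Nat.add_one_sub_one, pow_one, smul_eq_mul, nsmul_eq_mul, Nat.cast_ofNat]
  rw [hyG, integral_indicator hSm, Measure.restrict_restrict hSm,
    show S ∩ Ioi 0 = S from inter_eq_left.mpr inter_subset_right]
  have hc : ∫ x in S, 2 * π * x * hankelDensity φ x = 2 * π * ∫ x in S, x * hankelDensity φ x := by
    rw [← integral_const_mul]
    refine setIntegral_congr_fun hSm fun x _ => ?_
    ring
  rw [hc]
  ring

end Literature.Probability.Distributions

end
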